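/-
Copyright: cell `langlands-arthur-audit` (papers/Langlands/langlands-arthur-audit), unit `pub-arthur-carver-g4`
(CARVER gen 4, 2026-08-18).  Staged for the tree under `Literature/NumberTheory/Automorphic/Arthur2013/Leaves/`
(LEAN-IN-TREE rule 2026-08-18); imports the three DAG modules (M1, M10, M11) and `Leaves.Classification` (M19).
Module map: M22.
-/
import Literature.NumberTheory.Automorphic.Arthur2013.DependencyDag
import Literature.NumberTheory.Automorphic.Mok2015.DependencyDag
import Literature.NumberTheory.Automorphic.KMSW2014.DependencyDag
import Literature.NumberTheory.Automorphic.Arthur2013.Leaves.Classification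

/-!
# Arthur (2013) audit, typed leaves — §9b FULL-CONTENT READINGS of the DAG nodes T151, [Mok] T251, [KMSW] T161 / T161g

Answers the cell finding GAPS G-TY-4-1 (typer-g4): the landed bridge `KMSW2014/LeavesBridge.lean` reads the DAG
nodes `KMSW2014.Nodes.T161g` / `T161` as §5's `LocalClassification` (module `Leaves/Packets.lean`), which
`LocalClassificationFull.strictly_stronger` (module `Leaves/Classification.lean`, M19) shows to be STRICTLY WEAKER
than the printed theorems ([TIFR] p.4 (b) "Finally Π̃_temp(G) = ∐_{φ∈Φ̃_bdd(G)} Π̃_φ."; [Mok] Thm 2.5.1(b)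
`main.tex:L1246`; [KMSW] Thm* 1.6.1 part 6 `chap1mainthms.tex:L108`), and no landed module reads the [Ar] node
`Arthur2013.Nodes.T151` or the [Mok] node `Mok2015.Nodes.T251` at all.  Following G-TY-4-1's recommendation
("a NEW bridge module (never edit the landed ones) with fields `(∀ N, ν.T151 N) ↔ Book.T151 Ω D T` etc."),
this module states, as HYPOTHESES a reader may adopt, that those DAG nodes ARE the printed local classification
theorems IN FULL (`Book.T151`, `Mok.T251`, `KMSW.T161`, `KMSW.T161g` of M19), and proves:

* `Book.T151_of_leaves` / `Mok.T251_of_leaves` / `KMSW.T161g_of_leaves` / `KMSW.T161_of_leaves` — under the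
  full reading, the printed theorem in full follows from EXACTLY the leaf bundles of the respective kernel DAG
  (`Arthur2013.Nodes.T151_of_leaves`, `Mok2015.Nodes.T251_of_leaves`, `KMSW2014.Nodes.scope_of_leaves` /
  `full_of_leaves`): the 2026 status of T151 in full is that of the leaf set of LEMMAS.md §2 (no new leaf);
* `…fullNodes_reads` — the full readings are CONSISTENT (a node assignment satisfying them exists);
* `KMSW.ReadsFull.toLanded` — the full reading implies the landed bridge's weaker reading of the same nodes
  (`LocalClassificationFull.toLocal`), so nothing certified against `KMSW2014/LeavesBridge.lean` is lost;
* `Book.weak_reading_not_full` / `Mok.weak_reading_not_full` / `KMSW.weak_reading_not_full` — the §5-style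
  reading does NOT give the printed theorem (transport of `LocalClassificationFull.instances`): a certification
  of "T151" against a §5-style reading certifies the endoscopic-character-relation half only (LEMMAS.md §5 note).

Nothing here asserts that any node is true, reads any OTHER node, or touches a landed statement.  The Book
`Arthur2013` is NOT held by the cell (acq-04129): "[Ar, Thm 1.5.1]" is the survey's `Arthur2013Survey` p.4
restatement, second-hand, exactly as in M19.  No `axiom`, `sorry`, `opaque`; no Mathlib.
-/

set_option autoImplicit false

namespace Literature.NumberTheory.Automorphic.Arthur2013.Leaves

section FullReads

variable {Ω : World} {D : ShapeData Ω} {T : TemperedData Ω}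

/-- **Full reading of the [Ar] node T151.**  Hypothesis: the DAG node `Arthur2013.Nodes.T151` (at every rank
`N`; the DAG indexes [Ar, Thm 1.5.1] by the rank of the induction, the printed statement is the conjunction over
all ranks) is the local classification theorem IN FULL on the Book's stated region, `Book.T151 Ω D T` of M19
([TIFR] Theorem 1 = [A, Theorem 1.5.1], `[paper:url-560716e7679e p.4]`, quoted verbatim in M19).
[cite: Arthur2013, Thm 1.5.1 (restated in Arthur2013Survey p.4; reading hypothesis, GAPS G-TY-4-1)] -/
structure Book.ReadsFull (ν : Nodes) (Ω : World) (D : ShapeData Ω) (T : TemperedData Ω) : Prop where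
  /-- T151 at every rank ↔ Thm 1.5.1 in full on `Book.localStated` -/
  t151 : (∀ N, ν.T151 N) ↔ Book.T151 Ω D T

/-- **Full reading of the [Mok] node T251.**  Hypothesis: `Mok2015.Nodes.T251` at every rank is [Mok] Thm 2.5.1
with its printed part (b) on its stated region, `Mok.T251 Ω D T` of M19 (`main.tex:L1230–L1256`, verbatim in M19).
[cite: Mok2012, Thm 2.5.1 (l.1230-1256; reading hypothesis, GAPS G-TY-4-1)] -/
structure Mok.ReadsFull (μ : Mok2015.Nodes) (Ω : World) (D : ShapeData Ω) (T : TemperedData Ω) : Prop where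
  /-- T251 at every rank ↔ Thm 2.5.1 in full on `Mok.localStated` -/
  t251 : (∀ N, μ.T251 N) ↔ Mok.T251 Ω D T

/-- **Full readings of the [KMSW] nodes T161 (as stated) and T161g (as proved, generic ψ).**  Hypotheses:
`KMSW2014.Nodes.T161` / `T161g` at every rank are Thm* 1.6.1 parts 4–6 in full on `KMSW.localStated` /
`KMSW.localProved`, i.e. `KMSW.T161` / `KMSW.T161g` of M19 (`chap1mainthms.tex:L88–L113`, `L86`).  Compare the
landed `KMSW2014.ReadsLeaves.t161` / `t161g` (M15), which read the same nodes as §5's `LocalClassification`.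
[cite: KalethaEtAl2014, Thm* 1.6.1 (l.86-113; reading hypothesis, GAPS G-TY-4-1)] -/
structure KMSW.ReadsFull (κ : KMSW2014.Nodes) (Ω : World) (D : ShapeData Ω) (T : TemperedData Ω) : Prop where
  /-- T161 at every rank ↔ Thm* 1.6.1(4)–(6) as stated, in full -/
  t161 : (∀ N, κ.T161 N) ↔ KMSW.T161 Ω D T
  /-- T161g at every rank ↔ Thm* 1.6.1(4)–(6) for generic ψ, in full -/
  t161g : (∀ N, κ.T161g N) ↔ KMSW.T161g Ω D T

/-- **[Ar, Thm 1.5.1] IN FULL from the leaves.**  Under the full reading, the printed local classification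
theorem — tempered members, disjointness and exhaustion included — follows from the book-internal edges, the
supply edges and EXACTLY the three leaf bundles of the kernel DAG (M1 `Nodes.T151_of_leaves`); its 2026 status is
therefore that of the leaf set (LEMMAS.md §2: 15 PUBLISHED / 7 PREPRINT / 2 STILL-UNWRITTEN), with no new leaf.
[cite: Arthur2013, Thm 1.5.1 (bookkeeping proved here; via Arthur2013Survey p.4)] -/
theorem Book.T151_of_leaves {ν : Nodes} (h : Book.ReadsFull ν Ω D T) (B : ν.BookEdges) (S : ν.SupplyEdges)
    (P : ν.PublishedLeaves) (Q : ν.PreprintLeaves2026) (U : ν.UnwrittenLeaves) : Book.T151 Ω D T :=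
  h.t151.mp (ν.T151_of_leaves B S P Q U)

/-- **[Mok, Thm 2.5.1] IN FULL from the leaves** of the Mok DAG (M10 `Mok2015.Nodes.T251_of_leaves`), under the
full reading. [cite: Mok2012, Thm 2.5.1 (bookkeeping proved here)] -/
theorem Mok.T251_of_leaves {μ : Mok2015.Nodes} (h : Mok.ReadsFull μ Ω D T) (B : μ.SectionEdges)
    (S : μ.SupplyEdges) (P : μ.PublishedLeaves) (Q : μ.PreprintLeaves2026) (U : μ.UnwrittenLeaves) :
    Mok.T251 Ω D T :=
  h.t251.mp (μ.T251_of_leaves B S P Q U)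

/-- **[KMSW, Thm* 1.6.1(4)–(6)] for generic ψ IN FULL from the leaves** of the KMSW DAG in its PROVED scope
(M11 `KMSW2014.Nodes.scope_of_leaves`: chapter edges, supply edges, the Mok import, published leaves, the general
weighted fundamental lemma), under the full reading. [cite: KalethaEtAl2014, Thm* 1.6.1 for generic ψ (l.86; bookkeeping proved here)] -/
theorem KMSW.T161g_of_leaves {κ : KMSW2014.Nodes} (h : KMSW.ReadsFull κ Ω D T) (B : κ.ChapterEdges)
    (S : κ.SupplyEdges) (I : κ.ImportedLeaves) (P : κ.PublishedLeaves) (U : κ.UnwrittenLeaves) :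
    KMSW.T161g Ω D T :=
  h.t161g.mp fun N => (κ.scope_of_leaves B S I P U N).1

/-- **[KMSW, Thm* 1.6.1(4)–(6)] AS STATED, IN FULL, from the leaves** — needs in addition the two unwritten
sequels (M11 `KMSW2014.Nodes.full_of_leaves`, edge `E_Full`), under the full reading.
[cite: KalethaEtAl2014, Thm* 1.6.1 as stated (l.88-113; bookkeeping proved here)] -/
theorem KMSW.T161_of_leaves {κ : KMSW2014.Nodes} (h : KMSW.ReadsFull κ Ω D T) (B : κ.ChapterEdges)
    (S : κ.SupplyEdges) (I : κ.ImportedLeaves) (P : κ.PublishedLeaves) (U : κ.UnwrittenLeaves)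
    (Q : κ.UnwrittenSequels) : KMSW.T161 Ω D T :=
  h.t161.mp fun N => (κ.full_of_leaves B S I P U Q N).1

/-- **Compatibility with the landed bridge (M15).**  The full reading of the KMSW nodes implies the content the
landed `KMSW2014.ReadsLeaves.t161g` / `t161` fields give them (§5's statement on the same regions), by
`LocalClassificationFull.toLocal`: whatever was certified against the weaker reading stays certified.
[folklore] (bookkeeping) -/
theorem KMSW.ReadsFull.toLanded {κ : KMSW2014.Nodes} (h : KMSW.ReadsFull κ Ω D T) :
    ((∀ N, κ.T161g N) → LocalClassification Ω D KMSW.localProved) ∧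
      ((∀ N, κ.T161 N) → LocalClassification Ω D KMSW.localStated) :=
  ⟨fun H => LocalClassificationFull.toLocal Ω D T _ (h.t161g.mp H),
   fun H => LocalClassificationFull.toLocal Ω D T _ (h.t161.mp H)⟩

/-- Under the full reading the [Ar] node also carries §5's statement on the Book's region (the endoscopic-
character-relation half). [folklore] (bookkeeping) -/
theorem Book.ReadsFull.toLocal {ν : Nodes} (h : Book.ReadsFull ν Ω D T) :
    (∀ N, ν.T151 N) → LocalClassification Ω D Book.localStated :=
  fun H => LocalClassificationFull.toLocal Ω D T _ (h.t151.mp H)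

/-- A node assignment reading T151 in full (all other nodes arbitrary). [folklore] (consistency witness) -/
def Book.fullNodes (Ω : World) (D : ShapeData Ω) (T : TemperedData Ω) (rest : Nodes) : Nodes :=
  { rest with T151 := fun _ => Book.T151 Ω D T }

/-- The full reading of T151 is CONSISTENT: `Book.fullNodes` satisfies it. [folklore] (consistency) -/
theorem Book.fullNodes_reads (Ω : World) (D : ShapeData Ω) (T : TemperedData Ω) (rest : Nodes) :
    Book.ReadsFull (Book.fullNodes Ω D T rest) Ω D T where
  t151 := ⟨fun H => H 0, fun H _ => H⟩

/-- A node assignment reading [Mok] T251 in full. [folklore] (consistency witness) -/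
def Mok.fullNodes (Ω : World) (D : ShapeData Ω) (T : TemperedData Ω) (rest : Mok2015.Nodes) : Mok2015.Nodes :=
  { rest with T251 := fun _ => Mok.T251 Ω D T }

/-- The full reading of T251 is CONSISTENT. [folklore] (consistency) -/
theorem Mok.fullNodes_reads (Ω : World) (D : ShapeData Ω) (T : TemperedData Ω) (rest : Mok2015.Nodes) :
    Mok.ReadsFull (Mok.fullNodes Ω D T rest) Ω D T where
  t251 := ⟨fun H => H 0, fun H _ => H⟩

/-- A node assignment reading [KMSW] T161 / T161g in full. [folklore] (consistency witness) -/
def KMSW.fullNodes (Ω : World) (D : ShapeData Ω) (T : TemperedData Ω) (rest : KMSW2014.Nodes) :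
    KMSW2014.Nodes :=
  { rest with T161 := fun _ => KMSW.T161 Ω D T, T161g := fun _ => KMSW.T161g Ω D T }

/-- The full readings of T161 / T161g are CONSISTENT. [folklore] (consistency) -/
theorem KMSW.fullNodes_reads (Ω : World) (D : ShapeData Ω) (T : TemperedData Ω) (rest : KMSW2014.Nodes) :
    KMSW.ReadsFull (KMSW.fullNodes Ω D T rest) Ω D T where
  t161 := ⟨fun H => H 0, fun H _ => H⟩
  t161g := ⟨fun H => H 0, fun H _ => H⟩

/-- **The weak reading does not give the printed theorem ([Ar]).**  It is NOT the case that §5's statement on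
the Book's stated region implies Thm 1.5.1 in full for every world: transport of M19's
`LocalClassificationFull.instances` (the two-irreducible world).  Hence a certification of "T151" against a
§5-style reading certifies the endoscopic-character-relation half only (LEMMAS.md §5, G-TY-4-1).
[folklore] (assembled from `LocalClassificationFull.instances`) -/
theorem Book.weak_reading_not_full :
    ¬ ∀ (Ω : World) (D : ShapeData Ω) (T : TemperedData Ω),
        LocalClassification Ω D Book.localStated → Book.T151 Ω D T :=
  fun h => LocalClassificationFull.instances.1.2 (h _ _ _ LocalClassificationFull.instances.1.1)

/-- **The weak reading does not give the printed theorem ([Mok]).** [folklore] (assembled from `LocalClassificationFull.instances`) -/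
theorem Mok.weak_reading_not_full :
    ¬ ∀ (Ω : World) (D : ShapeData Ω) (T : TemperedData Ω),
        LocalClassification Ω D Mok.localStated → Mok.T251 Ω D T :=
  fun h => LocalClassificationFull.instances.2.1.2 (h _ _ _ LocalClassificationFull.instances.2.1.1)

/-- **The weak reading does not give the printed theorem ([KMSW], proved scope)** — in particular the landed
`KMSW2014.ReadsLeaves.t161g` reading is strictly weaker than `KMSW.ReadsFull.t161g`.
[folklore] (assembled from `LocalClassificationFull.instances`) -/
theorem KMSW.weak_reading_not_full :
    ¬ ∀ (Ω : World) (D : ShapeData Ω) (T : TemperedData Ω),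
        LocalClassification Ω D KMSW.localProved → KMSW.T161g Ω D T :=
  fun h => LocalClassificationFull.instances.2.2.2 (h _ _ _ LocalClassificationFull.instances.2.2.1)

end FullReads

end Literature.NumberTheory.Automorphic.Arthur2013.Leaves
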